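import Summits.CriticalPhenomena.PercolationContinuityZ3.Theorems.Transplant.FKConnectivityAllQHubCov
import Summits.CriticalPhenomena.PercolationContinuityZ3.Theorems.Transplant.FKConnectivityAllQTwoTree
import Summits.CriticalPhenomena.PercolationContinuityZ3.Theorems.FK.Transplant.KNFreePinningEmbedding
import HarnessLib

/-!
# Connectivity correlation inequalities for `φ_{w,q}`, every `q > 0` — TRANSPORT ALONG AN INJECTION OF VERTEX TYPES
# (idle vertices do not matter): support-level statements move from `V` to every larger `U`

Support file (`--supports stmt-CriticalPhenomena-4575`), FK sub-lane `prim-bschramm-fk-3` (gen 8) of the post-continuity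
programme; builds on p205010 (kernel theorem, internal audit signed; external expert review pending).  No definitions, no named
facts, no sorries; standard axioms.

The `q < 1` programme of the FK sub-lanes proves its inequalities SUPPORT-LEVEL on a fixed finite vertex type (`FK.EdgeNegCorrSupp S q`:
negative association of `φ_{w,q}` for every weight vector `w` supported in the edge set `S ⊆ Sym2 V`; fk-3's hub covariance bound
`FK.HubCovBoundUnder`), while kernel CERTIFICATES (fk-1 g5's `K₄`, fk-3 g5–g7's `RCEval` evaluations, the `W₄` hub pairs sized in
bschramm/FROM-fk-1-g7-CLUSTER-DOMINANCE.md §6(b)) live on a concrete small type such as `Fin 4` / `Fin 5`.  This file is the bookkeeping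
named in FK-BARRIER.md §11.4 'RECOMMENDED NEXT (2)' and in FROM-fk-1-g7 §6(b), on top of the fk-continuity cell's measure transport
`FK.rcMeasureW_real_preimage_image_sym2Map` (`…FK/Transplant/KNFreePinningEmbedding.lean`: along an injection `j : V ↪ U` of finite vertex types, a
weight vector `w` on `U` vanishing off the range of `Sym2.map j` is the weight vector `e ↦ w (j e)` on `V` padded with idle — isolated, unwired —
vertices, and `φ_{w,q}(A) = φ_{w∘j,q}{ω | j ω ∈ A}`, Grimmett 2006 (1.20) / Lemma (4.13)):
* the EVENT DICTIONARY of the programme — `FK.reachable_image_iff` / `FK.image_mem_openConn_iff` (`j ω ∈ {j x ↔ j y} ↔ ω ∈ {x ↔ y}`: open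
  paths of the image configuration only visit the range and pull back edge by edge), whence `FK.rcMeasureW_real_openConn_image`,
  `…_openConn_inter_image`, `…_compl_openConn_inter_image`, `…_openPair_image`, `…_openPair_inter_image`, and pairs off the range are almost
  surely closed (`…_openPair_inter_eq_zero_of_not_mem_range`);
* **`FK.hubCovBoundUnder_image_iff`** — the hub covariance bound at `(j x; j y, j z)` under `φ_{w,q}` is the bound at `(x; y, z)` under
  `φ_{w∘j,q}`; `FK.hubCovBoundUnder_image_of_forall`;
* **`FK.EdgeNegCorrSupp.image`** — if every weight vector on `V` supported in `S` gives an edge-negatively associated `φ_{·,q}`, then so does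
  every weight vector on `U` supported in `Sym2.map j '' S` (`0 < q`); in particular `FK.edgeNegCorrSupp_range_of_edgeNegCorrOn`:
  `EdgeNegCorrOn V q` gives `EdgeNegCorrSupp (range (Sym2.map j)) q` on every `U`.
So a certificate proved on `Fin n` becomes a theorem about every copy of that weighted graph inside every finite vertex type (the other
vertices idle), composable with the class operations already in the tree (two-sums `…TwoSum.lean`, apex steps, degree-three elimination
`…DegThree.lean`, minors via `EdgeNegCorrSupp.mono`).
[cite: Grimmett2006, §1.4 eq. (1.20) (p. 15); §4.2–4.3, Lemma (4.13) (p. 71)] [cite: Grimmett2006, §3.9 eq. (3.94) (pp. 63–64)]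
-/

noncomputable section

namespace Summit.CriticalPhenomena.PercolationContinuityZ3.Theorems

namespace FK

open MeasureTheory Literature.Probability.LatticeModels Literature.Probability.Percolation
open Literature.Probability.Percolation.DecisionTree (ind ind_of_mem ind_of_not_mem ind_nonneg)
open scoped Classical

variable {V U : Type*} (j : V ↪ U)

/-! ### The event dictionary: connections -/

/-- **Connections along the injection**: `j x ↔ j y` in the image configuration `j ω` iff `x ↔ y` in `ω` (the open graph of `j ω` is the image
graph; walks in it from a vertex of the range stay in the range and pull back). [cite: Grimmett2006, §4.3 (automorphism invariance)] -/
theorem reachable_image_iff (ω : BondConfig V) (x y : V) :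
    (openGraph (Sym2.map j '' ω)).Reachable (j x) (j y) ↔ (openGraph ω).Reachable x y := by
  have hG : openGraph (Sym2.map j '' ω) = (openGraph ω).map j := by
    unfold openGraph
    exact fromEdgeSet_image_eq_map j ω
  rw [hG]
  constructor
  · intro h
    obtain ⟨y', hy', hr⟩ := exists_of_reachable_map j (openGraph ω) h
    rw [j.injective hy']
    exact hr
  · exact reachable_map_of_reachable j (openGraph ω)

/-- **Connections along the injection** (event form): `j ω ∈ openConn (j x) (j y) ↔ ω ∈ openConn x y`. [cite: Grimmett2006, §4.3 (automorphism invariance)] -/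
theorem image_mem_openConn_iff (ω : BondConfig V) (x y : V) :
    Sym2.map j '' ω ∈ (openConn (j x) (j y) : Set (BondConfig U)) ↔ ω ∈ (openConn x y : Set (BondConfig V)) :=
  reachable_image_iff j ω x y

variable [Fintype V] [Fintype U]

/-- **The random-cluster measure along an injection of vertex types, free boundary** (`0 < q`): if `w` vanishes off the range of `Sym2.map j`,
then `φ_{w,q}(A) = φ_{w∘j,q}{ω | j ω ∈ A}` for every event `A` (the fk-continuity cell's `rcMeasureW_real_preimage_image_sym2Map` at `B = ∅`).
[cite: Grimmett2006, §1.4 eq. (1.20) (p. 15); Lemma (4.13) (p. 71)] -/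
theorem rcMeasureW_real_image (w : Sym2 U → unitInterval) (hw : ∀ e, e ∉ Set.range (Sym2.map j) → w e = 0) {q : ℝ} (hq : 0 < q)
    (A : Set (BondConfig U)) :
    (rcMeasureW w q ∅).real A = (rcMeasureW (fun e => w (Sym2.map j e)) q ∅).real {ω : BondConfig V | Sym2.map j '' ω ∈ A} := by
  have h := rcMeasureW_real_preimage_image_sym2Map j w hw hq (∅ : Set V) A
  rw [Set.image_empty] at h
  exact h.symm

/-! ### The dictionary for the events of the `q < 1` programme -/

section Dictionary

variable (w : Sym2 U → unitInterval) (hw : ∀ e, e ∉ Set.range (Sym2.map j) → w e = 0) {q : ℝ} (hq : 0 < q)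
include hw hq

/-- Two-point connections: `φ_{w,q}(j x ↔ j y) = φ_{w∘j,q}(x ↔ y)`. [cite: Grimmett2006, §4.3 (automorphism invariance)] -/
theorem rcMeasureW_real_openConn_image (x y : V) :
    (rcMeasureW w q ∅).real (openConn (j x) (j y)) = (rcMeasureW (fun e => w (Sym2.map j e)) q ∅).real (openConn x y) := by
  rw [rcMeasureW_real_image j w hw hq]
  congr 1
  ext ω
  exact image_mem_openConn_iff j ω x y

/-- Double connections: `φ_{w,q}(j x ↔ j y, j x' ↔ j z) = φ_{w∘j,q}(x ↔ y, x' ↔ z)`. [cite: Grimmett2006, §4.3 (automorphism invariance)] -/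
theorem rcMeasureW_real_openConn_inter_image (x y x' z : V) :
    (rcMeasureW w q ∅).real (openConn (j x) (j y) ∩ openConn (j x') (j z)) =
      (rcMeasureW (fun e => w (Sym2.map j e)) q ∅).real (openConn x y ∩ openConn x' z) := by
  rw [rcMeasureW_real_image j w hw hq]
  congr 1
  ext ω
  simp only [Set.mem_setOf_eq, Set.mem_inter_iff]
  rw [image_mem_openConn_iff, image_mem_openConn_iff]

/-- Non-connection and connection: `φ_{w,q}(j x ↮ j y, j y' ↔ j z) = φ_{w∘j,q}(x ↮ y, y' ↔ z)`. [cite: Grimmett2006, §4.3 (automorphism invariance)] -/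
theorem rcMeasureW_real_compl_openConn_inter_image (x y y' z : V) :
    (rcMeasureW w q ∅).real ((openConn (j x) (j y) : Set (BondConfig U))ᶜ ∩ openConn (j y') (j z)) =
      (rcMeasureW (fun e => w (Sym2.map j e)) q ∅).real ((openConn x y : Set (BondConfig V))ᶜ ∩ openConn y' z) := by
  rw [rcMeasureW_real_image j w hw hq]
  congr 1
  ext ω
  simp only [Set.mem_setOf_eq, Set.mem_inter_iff, Set.mem_compl_iff]
  rw [image_mem_openConn_iff, image_mem_openConn_iff]

/-- Total mass: `φ_{w,q}(Ω_U) = φ_{w∘j,q}(Ω_V)`. [cite: Grimmett2006, §1.4 eq. (1.20) (p. 15)] -/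
theorem rcMeasureW_real_univ_image :
    (rcMeasureW w q ∅).real (Set.univ : Set (BondConfig U)) =
      (rcMeasureW (fun e => w (Sym2.map j e)) q ∅).real (Set.univ : Set (BondConfig V)) := by
  rw [rcMeasureW_real_image j w hw hq]
  congr 1

/-- Open pairs: `φ_{w,q}(J_{j e}) = φ_{w∘j,q}(J_e)`. [cite: Grimmett2006, §1.4 eq. (1.20) (p. 15)] -/
theorem rcMeasureW_real_openPair_image (e : Sym2 V) :
    (rcMeasureW w q ∅).real {η : BondConfig U | Sym2.map j e ∈ η} =
      (rcMeasureW (fun e => w (Sym2.map j e)) q ∅).real {ω : BondConfig V | e ∈ ω} := by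
  rw [rcMeasureW_real_image j w hw hq]
  congr 1
  ext ω
  simp only [Set.mem_setOf_eq]
  exact map_mem_image_iff j ω e

/-- Two open pairs: `φ_{w,q}(J_{j e} ∩ J_{j f}) = φ_{w∘j,q}(J_e ∩ J_f)`. [cite: Grimmett2006, §1.4 eq. (1.20) (p. 15)] -/
theorem rcMeasureW_real_openPair_inter_image (e f : Sym2 V) :
    (rcMeasureW w q ∅).real ({η : BondConfig U | Sym2.map j e ∈ η} ∩ {η | Sym2.map j f ∈ η}) =
      (rcMeasureW (fun e => w (Sym2.map j e)) q ∅).real ({ω : BondConfig V | e ∈ ω} ∩ {ω | f ∈ ω}) := by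
  rw [rcMeasureW_real_image j w hw hq]
  congr 1
  ext ω
  simp only [Set.mem_setOf_eq, Set.mem_inter_iff]
  rw [map_mem_image_iff, map_mem_image_iff]

omit [Fintype V] in
/-- A pair off the range is almost surely closed: `φ_{w,q}(J_e ∩ B) = 0` for `e ∉ range (Sym2.map j)`. [cite: Grimmett2006, §1.4 eq. (1.20) (p. 15)] -/
theorem rcMeasureW_real_openPair_inter_eq_zero_of_not_mem_range {e : Sym2 U} (he : e ∉ Set.range (Sym2.map j))
    (B : Set (BondConfig U)) : (rcMeasureW w q ∅).real ({η : BondConfig U | e ∈ η} ∩ B) = 0 := by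
  have h0 : ((w e : unitInterval) : ℝ) = 0 := by rw [hw e he]; rfl
  rw [rcMeasureW_real_eq_sum_div _ hq, sum_rcWeightW_ind_inter_openPair_of_zero w q h0 B, zero_div]

/-- **The hub covariance bound is transported**: for `w` vanishing off the range of `Sym2.map j`,
`HubCovBoundUnder (φ_{w,q}) q (j x) (j y) (j z) ↔ HubCovBoundUnder (φ_{w∘j,q}) q x y z`. [cite: Grimmett2006, §3.9 eq. (3.94) (pp. 63–64); §4.3] -/
theorem hubCovBoundUnder_image_iff (x y z : V) :
    HubCovBoundUnder (rcMeasureW w q ∅) q (j x) (j y) (j z) ↔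
      HubCovBoundUnder (rcMeasureW (fun e => w (Sym2.map j e)) q ∅) q x y z := by
  unfold HubCovBoundUnder
  rw [rcMeasureW_real_openConn_inter_image j w hw hq, rcMeasureW_real_openConn_image j w hw hq,
    rcMeasureW_real_openConn_image j w hw hq, rcMeasureW_real_compl_openConn_inter_image j w hw hq,
    rcMeasureW_real_univ_image j w hw hq]

end Dictionary

/-! ### Support-level statements move to every larger vertex type -/

omit [Fintype V] [Fintype U] in
/-- A weight vector supported in `Sym2.map j '' S` vanishes off the range of `Sym2.map j`. [folklore] -/
theorem eq_zero_of_supp_image {S : Set (Sym2 V)} {w : Sym2 U → unitInterval}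
    (hwS : ∀ e, ((w e : unitInterval) : ℝ) ≠ 0 → e ∈ Sym2.map j '' S) (e : Sym2 U) (he : e ∉ Set.range (Sym2.map j)) :
    w e = 0 := by
  by_contra h
  have h' : ((w e : unitInterval) : ℝ) ≠ 0 := fun h0 => h (Set.Icc.coe_eq_zero.1 h0)
  exact he (Set.image_subset_range _ _ (hwS e h'))

omit [Fintype V] [Fintype U] in
/-- The pulled-back weight vector of a weight vector supported in `Sym2.map j '' S` is supported in `S`. [folklore] -/
theorem supp_comp_of_supp_image {S : Set (Sym2 V)} {w : Sym2 U → unitInterval}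
    (hwS : ∀ e, ((w e : unitInterval) : ℝ) ≠ 0 → e ∈ Sym2.map j '' S) (e : Sym2 V)
    (he : ((w (Sym2.map j e) : unitInterval) : ℝ) ≠ 0) : e ∈ S := by
  obtain ⟨e', he', hee⟩ := hwS (Sym2.map j e) he
  rwa [← Sym2.map.injective j.injective hee]

/-- **Support-level edge-negative association is transported along injections of vertex types** (`0 < q`): if `φ_{v,q}` is edge-negatively
associated for every weight vector `v` on `V` supported in `S`, then `φ_{w,q}` is edge-negatively associated for every weight vector `w` on `U`
supported in `Sym2.map j '' S` (the copy of `S` inside `U`, all other vertices idle).  Pairs off the range are almost surely closed, so only image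
pairs matter, and for them the three probabilities are those of `φ_{w∘j,q}`. [cite: Grimmett2006, §3.9 eq. (3.94) (pp. 63–64); §4.3]
[cite: Wagner2006, Thm. 5.8, §5.3 (pp. 14–15)] -/
theorem EdgeNegCorrSupp.image {q : ℝ} (hq : 0 < q) {S : Set (Sym2 V)} (hS : EdgeNegCorrSupp S q) :
    EdgeNegCorrSupp (Sym2.map j '' S) q := by
  intro w hwS e f he hfe
  have hw : ∀ g, g ∉ Set.range (Sym2.map j) → w g = 0 := eq_zero_of_supp_image j hwS
  haveI := isProbabilityMeasure_rcMeasureW w hq (∅ : Set U)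
  by_cases heR : e ∈ Set.range (Sym2.map j)
  · obtain ⟨e', rfl⟩ := heR
    by_cases hfR : f ∈ Set.range (Sym2.map j)
    · obtain ⟨f', rfl⟩ := hfR
      have he' : ¬ e'.IsDiag := fun h => he ((Sym2.isDiag_map j.injective).2 h)
      have hfe' : f' ≠ e' := fun h => hfe (congrArg (Sym2.map j) h)
      rw [rcMeasureW_real_openPair_inter_image j w hw hq, rcMeasureW_real_openPair_image j w hw hq,
        rcMeasureW_real_openPair_image j w hw hq]
      exact hS (fun g => w (Sym2.map j g)) (supp_comp_of_supp_image j hwS) e' f' he' hfe'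
    · -- `f` off the range: both sides vanish
      have h0 : (rcMeasureW w q ∅).real ({η : BondConfig U | Sym2.map j e' ∈ η} ∩ {η | f ∈ η}) = 0 := by
        rw [Set.inter_comm]
        exact rcMeasureW_real_openPair_inter_eq_zero_of_not_mem_range j w hw hq hfR _
      have hf0 : (rcMeasureW w q ∅).real {η : BondConfig U | f ∈ η} = 0 := by
        have := rcMeasureW_real_openPair_inter_eq_zero_of_not_mem_range j w hw hq hfR Set.univ
        rwa [Set.inter_univ] at this
      rw [h0, hf0, mul_zero]
  · -- `e` off the range: the left side vanishes
    rw [rcMeasureW_real_openPair_inter_eq_zero_of_not_mem_range j w hw hq heR]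
    exact mul_nonneg measureReal_nonneg measureReal_nonneg

omit [Fintype U] in
/-- `EdgeNegCorrOn V q` is support-level negative association for the full support. [cite: Grimmett2006, §3.9 eq. (3.94) (p. 63)] -/
theorem edgeNegCorrSupp_univ_of_edgeNegCorrOn {q : ℝ} (h : EdgeNegCorrOn V q) : EdgeNegCorrSupp (Set.univ : Set (Sym2 V)) q :=
  fun w _ e f he hfe => h w e f he hfe

/-- **Negative association on `V` gives negative association on every copy of `V` inside a larger vertex type** (`0 < q`):
`EdgeNegCorrOn V q → EdgeNegCorrSupp (range (Sym2.map j)) q` on `U`, for every injection `j : V ↪ U`.  With a certificate on `Fin n` (e.g. fk-1's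
`edgeNegCorrOn_fin_four`) this yields the statement for that weighted graph placed anywhere in any finite vertex type, the remaining vertices idle.
[cite: Grimmett2006, §3.9 eq. (3.94) (pp. 63–64); §4.3] -/
theorem edgeNegCorrSupp_range_of_edgeNegCorrOn {q : ℝ} (hq : 0 < q) (h : EdgeNegCorrOn V q) :
    EdgeNegCorrSupp (Set.range (Sym2.map j)) q := by
  rw [← Set.image_univ]
  exact EdgeNegCorrSupp.image j hq (edgeNegCorrSupp_univ_of_edgeNegCorrOn h)

/-- **The hub covariance bound on `V` gives the bound on every copy of `V` inside a larger vertex type**: if the bound holds at `(x; y, z)` for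
every weight vector on `V`, it holds at `(j x; j y, j z)` for every weight vector on `U` vanishing off the range of `Sym2.map j` (`0 < q`).
[cite: Grimmett2006, §3.9 eq. (3.94) (pp. 63–64); §4.3] -/
theorem hubCovBoundUnder_image_of_forall {q : ℝ} (hq : 0 < q) {x y z : V}
    (h : ∀ v : Sym2 V → unitInterval, HubCovBoundUnder (rcMeasureW v q ∅) q x y z) (w : Sym2 U → unitInterval)
    (hw : ∀ e, e ∉ Set.range (Sym2.map j) → w e = 0) :
    HubCovBoundUnder (rcMeasureW w q ∅) q (j x) (j y) (j z) :=
  (hubCovBoundUnder_image_iff j w hw hq x y z).2 (h fun e => w (Sym2.map j e))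

end FK

end Summit.CriticalPhenomena.PercolationContinuityZ3.Theorems

end
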